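import Mathlib
import HarnessLib
import Summits.NavierStokesRegularity.NavierStokesRegularity.Theorems.UnthreadedDoorAntidynamoWallEvenSector
import Summits.NavierStokesRegularity.NavierStokesRegularity.Theorems.UnthreadedDoorCellFluxAnalyticOrIrrotational

/-!
# Route `UnthreadedDoor` / `ThreadingFlux`, crux `PoloidalLiouville` (stmt-NavierStokesRegularity-1222), antidynamo v2 skeleton
# (sha16 `4ebf5683127b`), WALL `stub_scalarLiouville`: AN ORTHOGONAL DIRECTION AT TIMES ACCUMULATING AT ONE NEGATIVE INSTANT
# CLOSES THE WALL — and the EVEN SECTOR collapses to its all-time-stagnant core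

Support file (seat leafhand-ns-unthreadeddoor-2 g1, cell decomp-ns), `--supports stmt-NavierStokesRegularity-1222 --as helper`; theorems only.

The reusable closers of the earlier hands (`…WallTwoCentres`, `…WallSymmetricSector`, `…WallEvenSectorFarPast`) all need their direction
hypothesis on a FAR PAST `(−∞, t₁)`, because Z (`CellFlux.zonalUnthreadedVorticityVanishes` = KNSS Thm 5.2 in a moving frame) is a theorem about
ANCIENT solutions.  This file removes that restriction by ANALYTIC CONTINUATION IN TIME:

* `inner_cross_eq_zero_of_orthogonal` — three vectors orthogonal to one non-zero vector have zero triple product (reciprocal-basis expansion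
  `CellFlux.triple_smul_expand`).
* ★★ `curl_eq_zero_of_orthogonal_direction_frequently` — **THE ACCUMULATION CLOSER.**  A bounded ancient mild solution (duality class, measurable
  slices, jointly smooth) unthreaded about `x₀` at every `t < 0` which, at a set of times ACCUMULATING at some `t₀ < 0` (`∃ᶠ t in 𝓝[≠] t₀`), has a
  non-zero direction orthogonal to its whole vorticity slice, is IRROTATIONAL on `(−∞,0) × ℝ³`.  Proof: by the landed dichotomy
  `CellFlux.unthreadedAnalyticOrIrrotational` (Σ-5a + Z, unconditional) the flow is irrotational or jointly real-analytic IN ITS GIVEN FRAME; in the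
  analytic case every triple product `t ↦ ⟪ω(t,y₁), ω(t,y₂) × ω(t,y₃)⟫` is real-analytic on `(−∞,0)` (`CellFlux.analyticOnNhd_curl_uncurry`,
  `analyticAt_cross`, `analyticAt_inner`) and vanishes at the accumulating times, hence identically (identity theorem on the preconnected
  `Iio 0`); the rank-≤2 lemma `CellFlux.exists_ne_zero_forall_inner_eq_zero` then gives an orthogonal direction at EVERY `t < 0`, and Z concludes.
* `curl_eq_zero_of_orthogonal_direction_on_Ioo` — the same with the direction on any open time interval `(a,b)`, `a < b ≤ 0` (contains every
  far-past form), `constant_of_orthogonal_direction_frequently`, and the wall's letter `stubScalarLiouville_of_orthogonal_direction_frequently`.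
* ★★ `curl_eq_zero_of_two_centres_frequently` — a second centre of tangency at times accumulating at a negative instant ⇒ irrotational
  (sharpens `curl_eq_zero_of_two_centres_farPast`, p814898).
* ★★★ `curl_eq_zero_or_centre_stagnant_of_curl_even` — **THE EVEN SECTOR IS EXACTLY ITS STAGNANT CORE**: vorticity even about `x₀` at every
  `t < 0` ⇒ EITHER `curl v ≡ 0` on `(−∞,0) × ℝ³` OR `v(t, x₀) = 0` for EVERY `t < 0` (sharpens p814555/p814783, which needed `v(t,x₀) ≠ 0` on a far
  past: one non-stagnant instant now suffices, by continuity of `t ↦ v(t,x₀)` and the accumulation closer fed with the even-sector identity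
  `⟪v(t,x₀), ω(t,·)⟫ ≡ 0`, p814555); `constant_or_centre_stagnant_of_curl_even`; the wall's letter `stubScalarLiouville_or_centre_stagnant_of_even_potential`.

MEANING FOR THE WALL (repair census): every «far past» sector hypothesis of the g0 table may be replaced by «at times accumulating at one
negative instant»; the even residual is now EXACTLY the class {T(t,·) even about x₀ ∧ v(t,x₀) = 0 for all t < 0} (it contains the NS-invariant
centrally symmetric core v(t,x₀+y) = −v(t,x₀−y)).  HONEST LABEL: elementary corollaries of Σ-5a + Z + the identity theorem; nothing here proves
`stub_scalarLiouville`, `PoloidalLiouville` (1222), or bears on Navier–Stokes regularity; no summit statement is proved (crux 1222 is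
INCOMPARABLE with the summit). [folklore]
[cite: KochNadirashviliSereginSverak2009, Thm 5.2 (arXiv:0709.3599 pp. 9–10); LemarieRieusset2016, Thm. 9.12]
-/

noncomputable section

-- the summit and its single sub-problem share the name (CONVENTIONS §1)
set_option linter.dupNamespace false

open scoped Topology InnerProductSpace RealInnerProductSpace ContDiff
open Filter Set Function Metric MeasureTheory
open Literature.Analysis.FluidPDE

namespace Summit.NavierStokesRegularity.NavierStokesRegularity.Theorems.PoloidalLiouville.Antidynamo

open Summit.NavierStokesRegularity.NavierStokesRegularity.Theorems.PoloidalLiouville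
  (toroidalPotential exists_norm_curl_le constantOfIrrotational)

/-! ### Linear algebra: vectors orthogonal to a non-zero direction are linearly dependent -/

/-- Three vectors of `ℝ³` orthogonal to one non-zero vector `e` have zero triple product: `⟪a, b × c⟫ = 0` (from the reciprocal-basis expansion
`⟪a, b × c⟫ • e = ⟪a, e⟫ • (b × c) + ⟪b, e⟫ • (c × a) + ⟪c, e⟫ • (a × b)`). [folklore] -/
theorem inner_cross_eq_zero_of_orthogonal {e a b c : EuclideanSpace ℝ (Fin 3)} (he : e ≠ 0)
    (ha : ⟪e, a⟫ = 0) (hb : ⟪e, b⟫ = 0) (hc : ⟪e, c⟫ = 0) : ⟪a, cross b c⟫ = 0 := by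
  have h := CellFlux.triple_smul_expand a b c e
  rw [real_inner_comm e a, real_inner_comm e b, real_inner_comm e c, ha, hb, hc, zero_smul, zero_smul, zero_smul,
    add_zero, add_zero] at h
  exact (smul_eq_zero.1 h).resolve_right he

/-! ### ★★ The accumulation closer -/

/-- ★★ **AN ORTHOGONAL DIRECTION AT TIMES ACCUMULATING AT A NEGATIVE INSTANT ⇒ IRROTATIONAL.**  Let `v` be a bounded ancient mild solution
(`ν = 1`, duality class) with measurable slices, jointly smooth on `(−∞,0) × ℝ³` and unthreaded about `x₀` (`⟪x − x₀, curl v(t,x)⟫ = 0` for all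
`t < 0`, `x`).  If for some `t₀ < 0` there are, at times `t` accumulating at `t₀` (frequently in the punctured neighbourhood filter `𝓝[≠] t₀`),
non-zero directions `e` orthogonal to the whole vorticity slice (`⟪e, curl v(t, x)⟫ = 0` for all `x`), then `curl v ≡ 0` on `(−∞,0) × ℝ³`.
[Analytic-or-irrotational dichotomy; in the analytic frame the triple products `⟪ω(t,y₁), ω(t,y₂) × ω(t,y₃)⟫` are analytic in `t` and vanish
frequently near `t₀`, hence identically on `(−∞,0)`; rank ≤ 2 at every time; Z.]
[cite: KochNadirashviliSereginSverak2009, Thm 5.2 (arXiv:0709.3599 pp. 9–10); LemarieRieusset2016, Thm. 9.12] -/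
theorem curl_eq_zero_of_orthogonal_direction_frequently
    (v : ℝ → EuclideanSpace ℝ (Fin 3) → EuclideanSpace ℝ (Fin 3)) (x₀ : EuclideanSpace ℝ (Fin 3))
    (hB : Literature.Analysis.FluidPDE.IsBoundedAncientMildSolution 1 v)
    (hm : ∀ t < 0, AEStronglyMeasurable (v t) volume)
    (hsm : ContDiffOn ℝ (⊤ : ℕ∞) (Function.uncurry v) (Set.Iio 0 ×ˢ Set.univ))
    (hun : ∀ t < 0, ∀ x, ⟪x - x₀, curl (v t) x⟫ = 0)
    (hdir : ∃ t₀ < 0, ∃ᶠ t in 𝓝[≠] t₀,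
      ∃ e : EuclideanSpace ℝ (Fin 3), e ≠ 0 ∧ ∀ x, ⟪e, curl (v t) x⟫ = 0) :
    ∀ t < 0, ∀ x, curl (v t) x = 0 := by
  obtain ⟨K, hK⟩ := exists_norm_curl_le hB hsm
  obtain ⟨T, -, -, hlink⟩ := toroidalPotential v x₀ K hsm hK hun
  rcases CellFlux.unthreadedAnalyticOrIrrotational v x₀ T hB hm hsm hlink with hA | hZ
  · -- the analytic frame: triple products of vorticity values are analytic in `t`
    have hω := CellFlux.analyticOnNhd_curl_uncurry hA
    have hωt : ∀ y : EuclideanSpace ℝ (Fin 3), AnalyticOnNhd ℝ (fun t => curl (v t) y) (Iio 0) := fun y t ht =>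
      (hω (t, y) ⟨ht, mem_univ _⟩).comp₂ analyticAt_id analyticAt_const
    have hF : ∀ y₁ y₂ y₃ : EuclideanSpace ℝ (Fin 3),
        AnalyticOnNhd ℝ (fun t => ⟪curl (v t) y₁, cross (curl (v t) y₂) (curl (v t) y₃)⟫) (Iio 0) :=
      fun y₁ y₂ y₃ t ht =>
        CellFlux.analyticAt_inner (hωt y₁ t ht) (CellFlux.analyticAt_cross (hωt y₂ t ht) (hωt y₃ t ht))
    obtain ⟨t₀, ht₀, hfr⟩ := hdir
    -- … and vanish frequently near `t₀`, hence everywhere on the preconnected `(−∞,0)`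
    have hF0 : ∀ y₁ y₂ y₃ : EuclideanSpace ℝ (Fin 3), ∀ t < 0,
        ⟪curl (v t) y₁, cross (curl (v t) y₂) (curl (v t) y₃)⟫ = 0 := by
      intro y₁ y₂ y₃ t ht
      have hfr' : ∃ᶠ s in 𝓝[≠] t₀, ⟪curl (v s) y₁, cross (curl (v s) y₂) (curl (v s) y₃)⟫ = 0 :=
        hfr.mono fun s ⟨e, he, hes⟩ => inner_cross_eq_zero_of_orthogonal he (hes y₁) (hes y₂) (hes y₃)
      exact (hF y₁ y₂ y₃).eqOn_zero_of_preconnected_of_frequently_eq_zero isPreconnected_Iio ht₀ hfr' ht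
    -- rank ≤ 2 at every time, then Z
    exact CellFlux.zonalUnthreadedVorticityVanishes v x₀ T hB hm hsm hlink fun t ht =>
      CellFlux.exists_ne_zero_forall_inner_eq_zero (fun y => curl (v t) y) fun y₁ y₂ y₃ => hF0 y₁ y₂ y₃ t ht
  · exact hZ

/-- **… ON AN OPEN TIME INTERVAL.**  The same with the orthogonal direction given at every time of an open interval `(a, b)`, `a < b ≤ 0`
(every far-past hypothesis `∀ t < t₁` is the case `a = t₁ − 1`, `b = t₁`). [cite: KochNadirashviliSereginSverak2009, Thm 5.2 (arXiv:0709.3599 pp. 9–10)] -/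
theorem curl_eq_zero_of_orthogonal_direction_on_Ioo
    (v : ℝ → EuclideanSpace ℝ (Fin 3) → EuclideanSpace ℝ (Fin 3)) (x₀ : EuclideanSpace ℝ (Fin 3))
    (hB : Literature.Analysis.FluidPDE.IsBoundedAncientMildSolution 1 v)
    (hm : ∀ t < 0, AEStronglyMeasurable (v t) volume)
    (hsm : ContDiffOn ℝ (⊤ : ℕ∞) (Function.uncurry v) (Set.Iio 0 ×ˢ Set.univ))
    (hun : ∀ t < 0, ∀ x, ⟪x - x₀, curl (v t) x⟫ = 0)
    (hdir : ∃ a b : ℝ, a < b ∧ b ≤ 0 ∧ ∀ t ∈ Ioo a b,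
      ∃ e : EuclideanSpace ℝ (Fin 3), e ≠ 0 ∧ ∀ x, ⟪e, curl (v t) x⟫ = 0) :
    ∀ t < 0, ∀ x, curl (v t) x = 0 := by
  obtain ⟨a, b, hab, hb, hdir⟩ := hdir
  have hmid : (a + b) / 2 ∈ Ioo a b := ⟨by linarith, by linarith⟩
  refine curl_eq_zero_of_orthogonal_direction_frequently v x₀ hB hm hsm hun ⟨(a + b) / 2, by linarith, ?_⟩
  have hIoo : ∀ᶠ t in 𝓝 ((a + b) / 2), t ∈ Ioo a b := Ioo_mem_nhds hmid.1 hmid.2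
  have hev : ∀ᶠ t in 𝓝[≠] ((a + b) / 2), ∃ e : EuclideanSpace ℝ (Fin 3), e ≠ 0 ∧ ∀ x, ⟪e, curl (v t) x⟫ = 0 :=
    (hIoo.mono fun t ht => hdir t ht).filter_mono nhdsWithin_le_nhds
  exact hev.frequently

/-- **… HENCE SLICE-WISE CONSTANT** (`constantOfIrrotational`). [cite: KochNadirashviliSereginSverak2009, Thm 5.2 (arXiv:0709.3599 pp. 9–10)] -/
theorem constant_of_orthogonal_direction_frequently
    (v : ℝ → EuclideanSpace ℝ (Fin 3) → EuclideanSpace ℝ (Fin 3)) (x₀ : EuclideanSpace ℝ (Fin 3))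
    (hB : Literature.Analysis.FluidPDE.IsBoundedAncientMildSolution 1 v)
    (hm : ∀ t < 0, AEStronglyMeasurable (v t) volume)
    (hsm : ContDiffOn ℝ (⊤ : ℕ∞) (Function.uncurry v) (Set.Iio 0 ×ˢ Set.univ))
    (hun : ∀ t < 0, ∀ x, ⟪x - x₀, curl (v t) x⟫ = 0)
    (hdir : ∃ t₀ < 0, ∃ᶠ t in 𝓝[≠] t₀,
      ∃ e : EuclideanSpace ℝ (Fin 3), e ≠ 0 ∧ ∀ x, ⟪e, curl (v t) x⟫ = 0) :
    ∀ t < 0, ∃ c : EuclideanSpace ℝ (Fin 3), ∀ x, v t x = c :=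
  constantOfIrrotational v hB hsm (curl_eq_zero_of_orthogonal_direction_frequently v x₀ hB hm hsm hun hdir)

/-- **THE WALL'S LETTER.**  If the vorticity of the wall's flow is `∇T(t,·) × (· − x₀)` and non-zero directions orthogonal to the whole vorticity
slice exist at times accumulating at some `t₀ < 0`, then `∇T × (x − x₀) ≡ 0` on `(−∞,0) × ℝ³`.
[cite: KochNadirashviliSereginSverak2009, Thm 5.2 (arXiv:0709.3599 pp. 9–10)] -/
theorem stubScalarLiouville_of_orthogonal_direction_frequently
    (v : ℝ → EuclideanSpace ℝ (Fin 3) → EuclideanSpace ℝ (Fin 3)) (x₀ : EuclideanSpace ℝ (Fin 3))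
    (T : ℝ → EuclideanSpace ℝ (Fin 3) → ℝ)
    (hB : Literature.Analysis.FluidPDE.IsBoundedAncientMildSolution 1 v)
    (hm : ∀ t < 0, AEStronglyMeasurable (v t) volume)
    (hsm : ContDiffOn ℝ (⊤ : ℕ∞) (Function.uncurry v) (Set.Iio 0 ×ˢ Set.univ))
    (hrep : ∀ t < 0, ∀ x, Literature.Analysis.FluidPDE.curl (v t) x =
      Literature.Analysis.FluidPDE.cross (gradient (T t) x) (x - x₀))
    (hdir : ∃ t₀ < 0, ∃ᶠ t in 𝓝[≠] t₀, ∃ e : EuclideanSpace ℝ (Fin 3), e ≠ 0 ∧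
      ∀ x, ⟪e, Literature.Analysis.FluidPDE.cross (gradient (T t) x) (x - x₀)⟫ = 0) :
    ∀ t < 0, ∀ x, Literature.Analysis.FluidPDE.cross (gradient (T t) x) (x - x₀) = 0 := by
  -- a toroidal field is tangent to the spheres about its centre: `⟪y, a × y⟫ = 0`
  have hun : ∀ t < 0, ∀ x, ⟪x - x₀, curl (v t) x⟫ = 0 := fun t ht x => by
    rw [hrep t ht x]
    simp [cross, crossProduct, PiLp.inner_apply, Fin.sum_univ_three]
    ring
  obtain ⟨t₀, ht₀, hfr⟩ := hdir
  have hfr' : ∃ᶠ t in 𝓝[≠] t₀, ∃ e : EuclideanSpace ℝ (Fin 3), e ≠ 0 ∧ ∀ x, ⟪e, curl (v t) x⟫ = 0 := by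
    have hneg0 : ∀ᶠ t in 𝓝 t₀, t < 0 := Iio_mem_nhds ht₀
    have hneg : ∀ᶠ t in 𝓝[≠] t₀, t < 0 := hneg0.filter_mono nhdsWithin_le_nhds
    exact (hfr.and_eventually hneg).mono fun t ⟨⟨e, he, hes⟩, ht⟩ => ⟨e, he, fun x => by rw [hrep t ht x]; exact hes x⟩
  intro t ht x
  rw [← hrep t ht x]
  exact curl_eq_zero_of_orthogonal_direction_frequently v x₀ hB hm hsm hun ⟨t₀, ht₀, hfr'⟩ t ht x

/-! ### ★★ A second centre at accumulating times -/

/-- ★★ **TWO CENTRES AT ACCUMULATING TIMES ⇒ IRROTATIONAL.**  A bounded ancient mild solution (duality class, measurable slices, jointly smooth)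
unthreaded about `x₀` at every `t < 0` and ALSO unthreaded about a second centre `x₁ ≠ x₀` at times accumulating at some `t₀ < 0` is irrotational
on `(−∞,0) × ℝ³` (`x₁ − x₀` is an orthogonal direction at those times).  Sharpens the far-past form `curl_eq_zero_of_two_centres_farPast`.
[cite: KochNadirashviliSereginSverak2009, Thm 5.2 (arXiv:0709.3599 pp. 9–10)] -/
theorem curl_eq_zero_of_two_centres_frequently
    (v : ℝ → EuclideanSpace ℝ (Fin 3) → EuclideanSpace ℝ (Fin 3)) (x₀ x₁ : EuclideanSpace ℝ (Fin 3)) (hx : x₁ ≠ x₀)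
    (hB : Literature.Analysis.FluidPDE.IsBoundedAncientMildSolution 1 v)
    (hm : ∀ t < 0, AEStronglyMeasurable (v t) volume)
    (hsm : ContDiffOn ℝ (⊤ : ℕ∞) (Function.uncurry v) (Set.Iio 0 ×ˢ Set.univ))
    (hun : ∀ t < 0, ∀ x, ⟪x - x₀, curl (v t) x⟫ = 0)
    (hun₁ : ∃ t₀ < 0, ∃ᶠ t in 𝓝[≠] t₀, ∀ x, ⟪x - x₁, curl (v t) x⟫ = 0) :
    ∀ t < 0, ∀ x, curl (v t) x = 0 := by
  obtain ⟨t₀, ht₀, hfr⟩ := hun₁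
  refine curl_eq_zero_of_orthogonal_direction_frequently v x₀ hB hm hsm hun ⟨t₀, ht₀, ?_⟩
  have hneg0 : ∀ᶠ t in 𝓝 t₀, t < 0 := Iio_mem_nhds ht₀
  have hneg : ∀ᶠ t in 𝓝[≠] t₀, t < 0 := hneg0.filter_mono nhdsWithin_le_nhds
  refine (hfr.and_eventually hneg).mono fun t ⟨h1, ht⟩ => ⟨x₁ - x₀, sub_ne_zero.2 hx, fun x => ?_⟩
  have h0 := hun t ht x
  have e : x₁ - x₀ = (x - x₀) - (x - x₁) := by abel
  rw [e, inner_sub_left, h0, h1 x, sub_zero]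

/-- ★★ **… HENCE SLICE-WISE CONSTANT.** [cite: KochNadirashviliSereginSverak2009, Thm 5.2 (arXiv:0709.3599 pp. 9–10)] -/
theorem constant_of_two_centres_frequently
    (v : ℝ → EuclideanSpace ℝ (Fin 3) → EuclideanSpace ℝ (Fin 3)) (x₀ x₁ : EuclideanSpace ℝ (Fin 3)) (hx : x₁ ≠ x₀)
    (hB : Literature.Analysis.FluidPDE.IsBoundedAncientMildSolution 1 v)
    (hm : ∀ t < 0, AEStronglyMeasurable (v t) volume)
    (hsm : ContDiffOn ℝ (⊤ : ℕ∞) (Function.uncurry v) (Set.Iio 0 ×ˢ Set.univ))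
    (hun : ∀ t < 0, ∀ x, ⟪x - x₀, curl (v t) x⟫ = 0)
    (hun₁ : ∃ t₀ < 0, ∃ᶠ t in 𝓝[≠] t₀, ∀ x, ⟪x - x₁, curl (v t) x⟫ = 0) :
    ∀ t < 0, ∃ c : EuclideanSpace ℝ (Fin 3), ∀ x, v t x = c :=
  constantOfIrrotational v hB hsm (curl_eq_zero_of_two_centres_frequently v x₀ x₁ hx hB hm hsm hun hun₁)

/-! ### ★★★ The even sector is exactly its stagnant core -/

/-- ★★★ **EVEN VORTICITY ⇒ IRROTATIONAL OR STAGNANT CENTRE AT ALL TIMES.**  Let `v` be a bounded ancient mild solution (`ν = 1`, duality class)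
with measurable slices, jointly smooth on `(−∞,0) × ℝ³`, unthreaded about `x₀` and with vorticity EVEN under the point reflection about `x₀`
(`curl v(t)(x₀ + x₀ − x) = curl v(t)(x)`) at every `t < 0`.  Then EITHER `curl v ≡ 0` on `(−∞,0) × ℝ³`, OR `v(t, x₀) = 0` for EVERY `t < 0`.
[If `v(t₁, x₀) ≠ 0` at one `t₁ < 0`, continuity of `t ↦ v(t, x₀)` makes it non-zero near `t₁`; by the even-sector identity
`⟪v(t,x₀), curl v(t,·)⟫ ≡ 0` (p814555) these are orthogonal directions at times accumulating at `t₁`; the accumulation closer concludes.]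
[cite: KochNadirashviliSereginSverak2009, Thm 5.2 (arXiv:0709.3599 pp. 9–10)] -/
theorem curl_eq_zero_or_centre_stagnant_of_curl_even
    (v : ℝ → EuclideanSpace ℝ (Fin 3) → EuclideanSpace ℝ (Fin 3)) (x₀ : EuclideanSpace ℝ (Fin 3))
    (hB : Literature.Analysis.FluidPDE.IsBoundedAncientMildSolution 1 v)
    (hm : ∀ t < 0, AEStronglyMeasurable (v t) volume)
    (hsm : ContDiffOn ℝ (⊤ : ℕ∞) (Function.uncurry v) (Set.Iio 0 ×ˢ Set.univ))
    (hun : ∀ t < 0, ∀ x, ⟪x - x₀, curl (v t) x⟫ = 0)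
    (hev : ∀ t < 0, ∀ x, curl (v t) (x₀ + x₀ - x) = curl (v t) x) :
    (∀ t < 0, ∀ x, curl (v t) x = 0) ∨ ∀ t < 0, v t x₀ = 0 := by
  by_cases hst : ∀ t < 0, v t x₀ = 0
  · exact Or.inr hst
  · left
    push Not at hst
    obtain ⟨t₁, ht₁, hne⟩ := hst
    have hperp := inner_centreVelocity_curl_eq_zero_of_curl_even v x₀ hB hm hsm hun hev
    -- `t ↦ v(t, x₀)` is continuous at `t₁`, hence non-zero near `t₁`
    have hcont : ContinuousAt (fun s : ℝ => v s x₀) t₁ := by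
      have h1 : ContinuousAt (Function.uncurry v) (t₁, x₀) :=
        hsm.continuousOn.continuousAt ((isOpen_Iio.prod isOpen_univ).mem_nhds ⟨ht₁, mem_univ _⟩)
      have h2 : ContinuousAt (fun s : ℝ => (s, x₀)) t₁ := (continuous_id.prodMk continuous_const).continuousAt
      exact ContinuousAt.comp (f := fun s : ℝ => (s, x₀)) (x := t₁) h1 h2
    have hne' : ∀ᶠ s in 𝓝 t₁, v s x₀ ≠ 0 := hcont.eventually_ne hne
    have hneg : ∀ᶠ s in 𝓝 t₁, s < 0 := Iio_mem_nhds ht₁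
    refine curl_eq_zero_of_orthogonal_direction_frequently v x₀ hB hm hsm hun ⟨t₁, ht₁, ?_⟩
    have h3 : ∀ᶠ s in 𝓝[≠] t₁, ∃ e : EuclideanSpace ℝ (Fin 3), e ≠ 0 ∧ ∀ x, ⟪e, curl (v s) x⟫ = 0 :=
      ((hne'.and hneg).mono fun s ⟨hs, hs0⟩ => ⟨v s x₀, hs, hperp s hs0⟩).filter_mono nhdsWithin_le_nhds
    exact h3.frequently

/-- ★★★ **… HENCE: EVEN VORTICITY ⇒ SLICE-WISE CONSTANT OR STAGNANT CENTRE AT ALL TIMES.**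
[cite: KochNadirashviliSereginSverak2009, Thm 5.2 (arXiv:0709.3599 pp. 9–10)] -/
theorem constant_or_centre_stagnant_of_curl_even
    (v : ℝ → EuclideanSpace ℝ (Fin 3) → EuclideanSpace ℝ (Fin 3)) (x₀ : EuclideanSpace ℝ (Fin 3))
    (hB : Literature.Analysis.FluidPDE.IsBoundedAncientMildSolution 1 v)
    (hm : ∀ t < 0, AEStronglyMeasurable (v t) volume)
    (hsm : ContDiffOn ℝ (⊤ : ℕ∞) (Function.uncurry v) (Set.Iio 0 ×ˢ Set.univ))
    (hun : ∀ t < 0, ∀ x, ⟪x - x₀, curl (v t) x⟫ = 0)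
    (hev : ∀ t < 0, ∀ x, curl (v t) (x₀ + x₀ - x) = curl (v t) x) :
    (∀ t < 0, ∃ c : EuclideanSpace ℝ (Fin 3), ∀ x, v t x = c) ∨ ∀ t < 0, v t x₀ = 0 := by
  rcases curl_eq_zero_or_centre_stagnant_of_curl_even v x₀ hB hm hsm hun hev with h | h
  · exact Or.inl (constantOfIrrotational v hB hsm h)
  · exact Or.inr h

/-- ★★★ **THE WALL'S LETTER ON THE EVEN SECTOR: TRIVIAL OR STAGNANT AT ALL TIMES.**  If the vorticity of the wall's flow is `∇T(t,·) × (· − x₀)`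
with `T(t, ·)` EVEN under the point reflection about `x₀` at every `t < 0`, then EITHER `∇T × (x − x₀) ≡ 0` on `(−∞,0) × ℝ³` OR `v(t, x₀) = 0`
for every `t < 0`.  (The even residual of the wall is exactly its all-time-stagnant core.)
[cite: KochNadirashviliSereginSverak2009, Thm 5.2 (arXiv:0709.3599 pp. 9–10)] -/
theorem stubScalarLiouville_or_centre_stagnant_of_even_potential
    (v : ℝ → EuclideanSpace ℝ (Fin 3) → EuclideanSpace ℝ (Fin 3)) (x₀ : EuclideanSpace ℝ (Fin 3))
    (T : ℝ → EuclideanSpace ℝ (Fin 3) → ℝ)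
    (hB : Literature.Analysis.FluidPDE.IsBoundedAncientMildSolution 1 v)
    (hm : ∀ t < 0, AEStronglyMeasurable (v t) volume)
    (hsm : ContDiffOn ℝ (⊤ : ℕ∞) (Function.uncurry v) (Set.Iio 0 ×ˢ Set.univ))
    (hrep : ∀ t < 0, ∀ x, Literature.Analysis.FluidPDE.curl (v t) x =
      Literature.Analysis.FluidPDE.cross (gradient (T t) x) (x - x₀))
    (hTeven : ∀ t < 0, ∀ x, T t (x₀ + x₀ - x) = T t x) :
    (∀ t < 0, ∀ x, Literature.Analysis.FluidPDE.cross (gradient (T t) x) (x - x₀) = 0) ∨ ∀ t < 0, v t x₀ = 0 := by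
  have hun : ∀ t < 0, ∀ x, ⟪x - x₀, curl (v t) x⟫ = 0 := fun t ht x => by
    rw [hrep t ht x]
    simp [cross, crossProduct, PiLp.inner_apply, Fin.sum_univ_three]
    ring
  have hev : ∀ t < 0, ∀ x, curl (v t) (x₀ + x₀ - x) = curl (v t) x := fun t ht =>
    curl_reflect_of_even_potential (hrep t ht) (hTeven t ht)
  rcases curl_eq_zero_or_centre_stagnant_of_curl_even v x₀ hB hm hsm hun hev with h | h
  · exact Or.inl fun t ht x => by rw [← hrep t ht x]; exact h t ht x
  · exact Or.inr h

end Summit.NavierStokesRegularity.NavierStokesRegularity.Theorems.PoloidalLiouville.Antidynamo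

end
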